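import Mathlib
import HarnessLib

/-!
# Stub `stub_calEnd` — the end piece of the calibration supersolution
(crux `LeeYang.LeeyangThesis`, line Sketch, card telegraph-string; calibration sub-programme,
RH-free real analysis)

For the calibration string with density `ρ(y) = 1/((L-y)² u(y)²)`, `u(y) = log(A/(L-y))`, on
`[0, L)` (`A ≥ e·L`), the end majorant near `y → L` is `g₂(y) = K - u(y)^{-1/2}` with
`K = u₀^{-1/2} (1 + 1/(2r))`, on `[y₁, L)`, `y₁ = L - A e^{-u₀}` (so `u(y₁) = u₀`), where
`u₀ ≥ log(A/L)` and `u₀ ≥ 2 + r + 2r²`.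

We prove: `0 ≤ y₁ < L`; `u(y₁) = u₀`; `g₂' = h` with `h(y) = (1/2) u^{-3/2}/(L-y)`; continuity of
`h` on `[y₁, L)`; the bounds `u₀^{-1/2}/(2r) ≤ g₂ ≤ K`; the slope identity at `y₁`; and the
integrated second-derivative inequality `h(y₁) + r² ∫_{y₁}^{y} ρ g₂ ≤ h(y)`.

Proof of the last item. With `s = u^{-1/2}` one has `h' = (1/2)(s³ - (3/2) s⁵)/(L-y)²` and
`r² ρ g₂ = r² s⁴ (K - s)/(L-y)²`; the pointwise inequality `r² s⁴ (K - s) ≤ (1/2)(s³ - (3/2)s⁵)`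
for `0 < s ≤ k₀ = u₀^{-1/2}` reduces (dividing by `s³`) to the quadratic inequality
`q(s) = 1/2 - (3/4) s² + r² s² - k₀ (r² + r/2) s ≥ 0`, which follows from the identity
`k₀² q(s) = s² (1/2 - k₀² (r/2 + 3/4)) + (1/2)(k₀ - s)((k₀ - s) + 2 s (1 - k₀² (r² + r/2)))`
and `k₀² u₀ = 1`, `u₀ ≥ 2 + r + 2 r²`. Integrating `h' ≥ r² ρ g₂` over `[y₁, y]`
(`intervalIntegral.integral_eq_sub_of_hasDerivAt`, `intervalIntegral.integral_mono_on`) gives the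
claim.
-/

noncomputable section

set_option linter.dupNamespace false

open MeasureTheory Filter Topology Set

namespace Summit.RiemannHypothesis.RiemannHypothesis.Theorems.LeeYangTelegraphString

/-- `u(y) = log(A/(L-y))` has derivative `1/(L-y)` at every `y < L` (`A > 0`). -/
private lemma calEnd_hasDerivAt_u {L A y : ℝ} (hA : 0 < A) (hy : y < L) :
    HasDerivAt (fun y : ℝ => Real.log (A / (L - y))) (1 / (L - y)) y := by
  have hLy : L - y ≠ 0 := (sub_pos.2 hy).ne'
  have h1 : HasDerivAt (fun y : ℝ => L - y) (-1) y := (hasDerivAt_id' y).const_sub L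
  have h2 := ((hasDerivAt_const y A).fun_div h1 hLy).log (div_ne_zero hA.ne' hLy)
  convert h2 using 1
  field_simp
  ring

/-- On `[y₁, L)`, `y₁ = L - A e^{-u₀}`, one has `u₀ ≤ u(y) = log(A/(L-y))`. -/
private lemma calEnd_u_ge {L A u₀ y : ℝ} (hA : 0 < A)
    (hy : y ∈ Set.Ico (L - A * Real.exp (-u₀)) L) : u₀ ≤ Real.log (A / (L - y)) := by
  have hLy : 0 < L - y := sub_pos.2 hy.2
  rw [Real.le_log_iff_exp_le (div_pos hA hLy), le_div_iff₀ hLy]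
  have h1 : L - y ≤ A * Real.exp (-u₀) := by linarith [hy.1]
  calc Real.exp u₀ * (L - y) ≤ Real.exp u₀ * (A * Real.exp (-u₀)) :=
        mul_le_mul_of_nonneg_left h1 (Real.exp_pos _).le
    _ = A := by
        rw [Real.exp_neg, mul_left_comm, mul_inv_cancel₀ (Real.exp_pos _).ne', mul_one]

/-- Power bookkeeping for `s = u^{-1/2}`, `u > 0`: `s > 0`, `s² u = 1`, `u^{-3/2} = s³`,
`u^{-5/2} = s⁵`. -/
private lemma calEnd_rpow_aux {u : ℝ} (hu : 0 < u) :
    0 < u ^ (-(1 / 2 : ℝ)) ∧ (u ^ (-(1 / 2 : ℝ))) ^ 2 * u = 1 ∧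
      u ^ (-(3 / 2 : ℝ)) = (u ^ (-(1 / 2 : ℝ))) ^ 3 ∧
      u ^ (-(5 / 2 : ℝ)) = (u ^ (-(1 / 2 : ℝ))) ^ 5 := by
  refine ⟨Real.rpow_pos_of_pos hu _, ?_, ?_, ?_⟩
  · have h2 : (u ^ (-(1 / 2 : ℝ))) ^ 2 = u⁻¹ := by
      rw [← Real.rpow_neg_one, ← Real.rpow_natCast, ← Real.rpow_mul hu.le]
      norm_num
    rw [h2, inv_mul_cancel₀ hu.ne']
  · rw [← Real.rpow_natCast, ← Real.rpow_mul hu.le]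
    norm_num
  · rw [← Real.rpow_natCast, ← Real.rpow_mul hu.le]
    norm_num

/-- `x ↦ x^{-1/2}` is antitone on `(0, ∞)`. -/
private lemma calEnd_rpow_le {u₀ u : ℝ} (hu₀ : 0 < u₀) (h : u₀ ≤ u) :
    u ^ (-(1 / 2 : ℝ)) ≤ u₀ ^ (-(1 / 2 : ℝ)) :=
  Real.rpow_le_rpow_of_nonpos hu₀ h (by norm_num)

/-- Derivative of the end majorant `g₂(y) = K - u(y)^{-1/2}`: `g₂'(y) = (1/2) u^{-3/2}/(L-y)`. -/
private lemma calEnd_hasDerivAt_g {L A y : ℝ} (K : ℝ) (hA : 0 < A) (hy : y < L)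
    (hu : 0 < Real.log (A / (L - y))) :
    HasDerivAt (fun y : ℝ => K - Real.log (A / (L - y)) ^ (-(1 / 2 : ℝ)))
      ((1 / 2) * Real.log (A / (L - y)) ^ (-(3 / 2 : ℝ)) / (L - y)) y := by
  have h := ((calEnd_hasDerivAt_u hA hy).rpow_const (p := -(1 / 2 : ℝ)) (Or.inl hu.ne')).const_sub K
  refine h.congr_deriv ?_
  rw [show (-(1 / 2 : ℝ) - 1) = -(3 / 2 : ℝ) by norm_num]
  ring

/-- Derivative of `h(y) = (1/2) u^{-3/2}/(L-y)`, written with `s = u^{-1/2}`: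
`h'(y) = (1/2)(s³ - (3/2) s⁵)/(L-y)²`. -/
private lemma calEnd_hasDerivAt_h {L A y : ℝ} (hA : 0 < A) (hy : y < L)
    (hu : 0 < Real.log (A / (L - y))) :
    HasDerivAt (fun y : ℝ => (1 / 2) * Real.log (A / (L - y)) ^ (-(3 / 2 : ℝ)) / (L - y))
      ((1 / 2) * ((Real.log (A / (L - y)) ^ (-(1 / 2 : ℝ))) ^ 3 -
        (3 / 2) * (Real.log (A / (L - y)) ^ (-(1 / 2 : ℝ))) ^ 5) / (L - y) ^ 2) y := by
  have hLy : L - y ≠ 0 := (sub_pos.2 hy).ne'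
  have h1 : HasDerivAt (fun y : ℝ => L - y) (-1) y := (hasDerivAt_id' y).const_sub L
  have h2 := (((calEnd_hasDerivAt_u hA hy).rpow_const (p := -(3 / 2 : ℝ))
    (Or.inl hu.ne')).const_mul (1 / 2 : ℝ)).fun_div h1 hLy
  refine h2.congr_deriv ?_
  obtain ⟨-, -, h3, h5⟩ := calEnd_rpow_aux hu
  rw [show (-(3 / 2 : ℝ) - 1) = -(5 / 2 : ℝ) by norm_num, h3, h5]
  field_simp
  ring

/-- Continuity of `h'` (in the `s`-form) at points of `[y₁, L)`. -/
private lemma calEnd_continuousAt_h' {L A t : ℝ} (hA : 0 < A) (ht : t < L)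
    (hu : 0 < Real.log (A / (L - t))) :
    ContinuousAt (fun t : ℝ => (1 / 2) * ((Real.log (A / (L - t)) ^ (-(1 / 2 : ℝ))) ^ 3 -
        (3 / 2) * (Real.log (A / (L - t)) ^ (-(1 / 2 : ℝ))) ^ 5) / (L - t) ^ 2) t := by
  have hLt : L - t ≠ 0 := (sub_pos.2 ht).ne'
  have hALt : A / (L - t) ≠ 0 := div_ne_zero hA.ne' hLt
  have hu' : Real.log (A / (L - t)) ≠ 0 := hu.ne'
  fun_prop (disch := first | assumption | exact Or.inl hu' | positivity)

/-- Continuity of `c · ρ · g₂` at points of `[y₁, L)`. -/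
private lemma calEnd_continuousAt_F {L A t : ℝ} (c K : ℝ) (hA : 0 < A) (ht : t < L)
    (hu : 0 < Real.log (A / (L - t))) :
    ContinuousAt (fun t : ℝ => c * ((1 / ((L - t) ^ 2 * Real.log (A / (L - t)) ^ 2)) *
        (K - Real.log (A / (L - t)) ^ (-(1 / 2 : ℝ))))) t := by
  have hLt : L - t ≠ 0 := (sub_pos.2 ht).ne'
  have hALt : A / (L - t) ≠ 0 := div_ne_zero hA.ne' hLt
  have hu' : Real.log (A / (L - t)) ≠ 0 := hu.ne'
  have hden : (L - t) ^ 2 * Real.log (A / (L - t)) ^ 2 ≠ 0 := by positivity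
  fun_prop (disch := first | assumption | exact Or.inl hu' | positivity)

/-- The algebraic heart of the supersolution inequality: for `0 < s ≤ k₀`, `k₀² u₀ = 1`,
`u₀ ≥ 2 + r + 2r²`, one has `r² s⁴ (k₀ (1 + 1/(2r)) - s) ≤ (1/2)(s³ - (3/2) s⁵)`. -/
private lemma calEnd_alg {r u₀ k₀ s : ℝ} (hr : 0 < r) (hu₀ : 2 + r + 2 * r ^ 2 ≤ u₀)
    (hk₀ : 0 < k₀) (hk : k₀ ^ 2 * u₀ = 1) (hs : 0 < s) (hsk : s ≤ k₀) :
    r ^ 2 * s ^ 4 * (k₀ * (1 + 1 / (2 * r)) - s) ≤ (1 / 2) * (s ^ 3 - (3 / 2) * s ^ 5) := by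
  have hK : r ^ 2 * (k₀ * (1 + 1 / (2 * r))) = k₀ * (r ^ 2 + r / 2) := by
    field_simp
  have h1 : 0 ≤ 1 / 2 - k₀ ^ 2 * (r / 2 + 3 / 4) := by
    nlinarith [mul_nonneg (sq_nonneg k₀) (sub_nonneg.2 hu₀),
      mul_nonneg (sq_nonneg k₀) (sq_nonneg r), mul_nonneg (sq_nonneg k₀) hr.le, sq_nonneg k₀]
  have h2 : 0 ≤ 1 - k₀ ^ 2 * (r ^ 2 + r / 2) := by
    nlinarith [mul_nonneg (sq_nonneg k₀) (sub_nonneg.2 hu₀),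
      mul_nonneg (sq_nonneg k₀) (sq_nonneg r), mul_nonneg (sq_nonneg k₀) hr.le, sq_nonneg k₀]
  have h3 : 0 ≤ k₀ - s := sub_nonneg.2 hsk
  have hq : 0 ≤ k₀ ^ 2 * (1 / 2 - (3 / 4) * s ^ 2 + r ^ 2 * s ^ 2 - k₀ * (r ^ 2 + r / 2) * s) := by
    have hid : k₀ ^ 2 * (1 / 2 - (3 / 4) * s ^ 2 + r ^ 2 * s ^ 2 - k₀ * (r ^ 2 + r / 2) * s) =
        s ^ 2 * (1 / 2 - k₀ ^ 2 * (r / 2 + 3 / 4)) +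
          (1 / 2) * (k₀ - s) * ((k₀ - s) + 2 * s * (1 - k₀ ^ 2 * (r ^ 2 + r / 2))) := by ring
    rw [hid]
    exact add_nonneg (mul_nonneg (sq_nonneg s) h1) (mul_nonneg (mul_nonneg (by norm_num) h3)
      (add_nonneg h3 (mul_nonneg (mul_nonneg (by norm_num) hs.le) h2)))
  have hq' : 0 ≤ 1 / 2 - (3 / 4) * s ^ 2 + r ^ 2 * s ^ 2 - k₀ * (r ^ 2 + r / 2) * s := by
    nlinarith [hq, pow_pos hk₀ 2]
  calc r ^ 2 * s ^ 4 * (k₀ * (1 + 1 / (2 * r)) - s)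
        = s ^ 4 * (r ^ 2 * (k₀ * (1 + 1 / (2 * r)))) - r ^ 2 * s ^ 5 := by ring
    _ = s ^ 4 * (k₀ * (r ^ 2 + r / 2)) - r ^ 2 * s ^ 5 := by rw [hK]
    _ ≤ (1 / 2) * (s ^ 3 - (3 / 2) * s ^ 5) := by nlinarith [mul_nonneg (pow_pos hs 3).le hq']

/-- The pointwise second-derivative inequality `r² ρ g₂ ≤ h'` on `[y₁, L)`. -/
private lemma calEnd_pointwise {L A r u₀ t : ℝ} (hA : 0 < A) (hr : 0 < r)
    (hu₂ : 2 + r + 2 * r ^ 2 ≤ u₀) (ht : t ∈ Set.Ico (L - A * Real.exp (-u₀)) L) :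
    r ^ 2 * ((1 / ((L - t) ^ 2 * Real.log (A / (L - t)) ^ 2)) *
      (u₀ ^ (-(1 / 2 : ℝ)) * (1 + 1 / (2 * r)) - Real.log (A / (L - t)) ^ (-(1 / 2 : ℝ)))) ≤
    (1 / 2) * ((Real.log (A / (L - t)) ^ (-(1 / 2 : ℝ))) ^ 3 -
        (3 / 2) * (Real.log (A / (L - t)) ^ (-(1 / 2 : ℝ))) ^ 5) / (L - t) ^ 2 := by
  have hu₀pos : 0 < u₀ := by nlinarith [sq_nonneg r]
  have hLt : 0 < L - t := sub_pos.2 ht.2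
  have hut : u₀ ≤ Real.log (A / (L - t)) := calEnd_u_ge hA ht
  have hsk : Real.log (A / (L - t)) ^ (-(1 / 2 : ℝ)) ≤ u₀ ^ (-(1 / 2 : ℝ)) :=
    calEnd_rpow_le hu₀pos hut
  set u := Real.log (A / (L - t)) with hu_def
  have hupos : 0 < u := hu₀pos.trans_le hut
  obtain ⟨hs, hsu, -, -⟩ := calEnd_rpow_aux hupos
  obtain ⟨hk, hku, -, -⟩ := calEnd_rpow_aux hu₀pos
  set s := u ^ (-(1 / 2 : ℝ)) with hs_def
  set k₀ := u₀ ^ (-(1 / 2 : ℝ)) with hk₀_def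
  have key := calEnd_alg hr hu₂ hk hku hs hsk
  have hu_eq : u = (s ^ 2)⁻¹ := eq_inv_of_mul_eq_one_right hsu
  rw [hu_eq]
  have hs2 : s ^ 2 ≠ 0 := by positivity
  have e1 : r ^ 2 * ((1 / ((L - t) ^ 2 * ((s ^ 2)⁻¹) ^ 2)) * (k₀ * (1 + 1 / (2 * r)) - s)) =
      (r ^ 2 * s ^ 4 * (k₀ * (1 + 1 / (2 * r)) - s)) / (L - t) ^ 2 := by
    field_simp
  rw [e1]
  exact div_le_div_of_nonneg_right key (by positivity)

/-- The integrated second-derivative inequality `h(y₁) + r² ∫_{y₁}^{y} ρ g₂ ≤ h(y)` on `[y₁, L)`,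
by the fundamental theorem of calculus for `h` and monotonicity of the integral. -/
private lemma calEnd_integral {L A r u₀ y : ℝ} (hA : 0 < A) (hr : 0 < r)
    (hu₂ : 2 + r + 2 * r ^ 2 ≤ u₀) (hlog : Real.log (A / (A * Real.exp (-u₀))) = u₀)
    (hy : y ∈ Set.Ico (L - A * Real.exp (-u₀)) L) :
    (1 / 2) * u₀ ^ (-(3 / 2 : ℝ)) / (A * Real.exp (-u₀)) +
        r ^ 2 * ∫ t in (L - A * Real.exp (-u₀))..y,
          (1 / ((L - t) ^ 2 * Real.log (A / (L - t)) ^ 2)) *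
          (u₀ ^ (-(1 / 2 : ℝ)) * (1 + 1 / (2 * r)) - Real.log (A / (L - t)) ^ (-(1 / 2 : ℝ))) ≤
      (1 / 2) * Real.log (A / (L - y)) ^ (-(3 / 2 : ℝ)) / (L - y) := by
  have hu₀pos : 0 < u₀ := by nlinarith [sq_nonneg r]
  have hsub : Set.Icc (L - A * Real.exp (-u₀)) y ⊆ Set.Ico (L - A * Real.exp (-u₀)) L :=
    fun t ht => ⟨ht.1, ht.2.trans_lt hy.2⟩
  have upos : ∀ t ∈ Set.Ico (L - A * Real.exp (-u₀)) L, 0 < Real.log (A / (L - t)) :=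
    fun t ht => hu₀pos.trans_le (calEnd_u_ge hA ht)
  rw [← Set.uIcc_of_le hy.1] at hsub
  have hderiv : ∀ t ∈ Set.uIcc (L - A * Real.exp (-u₀)) y,
      HasDerivAt (fun t : ℝ => (1 / 2) * Real.log (A / (L - t)) ^ (-(3 / 2 : ℝ)) / (L - t))
        ((1 / 2) * ((Real.log (A / (L - t)) ^ (-(1 / 2 : ℝ))) ^ 3 -
          (3 / 2) * (Real.log (A / (L - t)) ^ (-(1 / 2 : ℝ))) ^ 5) / (L - t) ^ 2) t :=
    fun t ht => calEnd_hasDerivAt_h hA (hsub ht).2 (upos t (hsub ht))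
  have hcont' : ContinuousOn (fun t : ℝ => (1 / 2) *
        ((Real.log (A / (L - t)) ^ (-(1 / 2 : ℝ))) ^ 3 -
          (3 / 2) * (Real.log (A / (L - t)) ^ (-(1 / 2 : ℝ))) ^ 5) / (L - t) ^ 2)
      (Set.uIcc (L - A * Real.exp (-u₀)) y) :=
    fun t ht => (calEnd_continuousAt_h' hA (hsub ht).2 (upos t (hsub ht))).continuousWithinAt
  have hFTC := intervalIntegral.integral_eq_sub_of_hasDerivAt hderiv hcont'.intervalIntegrable
  have hcontF : ContinuousOn (fun t : ℝ => r ^ 2 *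
        ((1 / ((L - t) ^ 2 * Real.log (A / (L - t)) ^ 2)) *
          (u₀ ^ (-(1 / 2 : ℝ)) * (1 + 1 / (2 * r)) - Real.log (A / (L - t)) ^ (-(1 / 2 : ℝ)))))
      (Set.uIcc (L - A * Real.exp (-u₀)) y) :=
    fun t ht => (calEnd_continuousAt_F _ _ hA (hsub ht).2 (upos t (hsub ht))).continuousWithinAt
  rw [Set.uIcc_of_le hy.1] at hsub
  have hmono := intervalIntegral.integral_mono_on (μ := volume) hy.1 hcontF.intervalIntegrable
    hcont'.intervalIntegrable (fun t ht => calEnd_pointwise hA hr hu₂ (hsub ht))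
  rw [intervalIntegral.integral_const_mul, hFTC, sub_sub_cancel, hlog] at hmono
  linarith [hmono]

/-- The end piece `g₂(y) = K - (log(A/(L-y)))^{-1/2}` of the supersolution near `L`, for
`u₀ ≥ 2 + r + 2r²`, `K = u₀^{-1/2}(1 + 1/(2r))`, on `[y₁, L)` with `y₁ = L - A e^{-u₀}`:
derivative, positivity, bound by `K`, value/slope at `y₁`, and the integrated second-derivative
inequality. -/
theorem stub_calEnd : ∀ (L A r u₀ : ℝ), 0 < L → Real.exp 1 * L ≤ A → 0 < r →
    Real.log (A / L) ≤ u₀ → 2 + r + 2 * r ^ 2 ≤ u₀ →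
    0 ≤ L - A * Real.exp (-u₀) ∧ L - A * Real.exp (-u₀) < L ∧
    Real.log (A / (L - (L - A * Real.exp (-u₀)))) = u₀ ∧
    (∀ y ∈ Set.Ico (L - A * Real.exp (-u₀)) L,
      HasDerivAt (fun y : ℝ => u₀ ^ (-(1 / 2 : ℝ)) * (1 + 1 / (2 * r)) -
        Real.log (A / (L - y)) ^ (-(1 / 2 : ℝ)))
      ((1 / 2) * Real.log (A / (L - y)) ^ (-(3 / 2 : ℝ)) / (L - y)) y) ∧
    ContinuousOn (fun y : ℝ => (1 / 2) * Real.log (A / (L - y)) ^ (-(3 / 2 : ℝ)) / (L - y))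
      (Set.Ico (L - A * Real.exp (-u₀)) L) ∧
    (∀ y ∈ Set.Ico (L - A * Real.exp (-u₀)) L,
      u₀ ^ (-(1 / 2 : ℝ)) * (1 / (2 * r)) ≤ u₀ ^ (-(1 / 2 : ℝ)) * (1 + 1 / (2 * r)) -
        Real.log (A / (L - y)) ^ (-(1 / 2 : ℝ)) ∧
      u₀ ^ (-(1 / 2 : ℝ)) * (1 + 1 / (2 * r)) - Real.log (A / (L - y)) ^ (-(1 / 2 : ℝ)) ≤
        u₀ ^ (-(1 / 2 : ℝ)) * (1 + 1 / (2 * r))) ∧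
    ((1 / 2) * u₀ ^ (-(3 / 2 : ℝ)) / (A * Real.exp (-u₀)) =
      r / ((A * Real.exp (-u₀)) * u₀) * (u₀ ^ (-(1 / 2 : ℝ)) * (1 / (2 * r)))) ∧
    ∀ y ∈ Set.Ico (L - A * Real.exp (-u₀)) L,
      (1 / 2) * u₀ ^ (-(3 / 2 : ℝ)) / (A * Real.exp (-u₀)) +
        r ^ 2 * ∫ t in (L - A * Real.exp (-u₀))..y,
          (1 / ((L - t) ^ 2 * Real.log (A / (L - t)) ^ 2)) *
          (u₀ ^ (-(1 / 2 : ℝ)) * (1 + 1 / (2 * r)) - Real.log (A / (L - t)) ^ (-(1 / 2 : ℝ))) ≤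
      (1 / 2) * Real.log (A / (L - y)) ^ (-(3 / 2 : ℝ)) / (L - y) := by
  intro L A r u₀ hL hA hr hu₁ hu₂
  have hApos : 0 < A := lt_of_lt_of_le (mul_pos (Real.exp_pos 1) hL) hA
  have hA0 : A ≠ 0 := hApos.ne'
  have hu₀pos : 0 < u₀ := by nlinarith [sq_nonneg r]
  have ht₁pos : 0 < A * Real.exp (-u₀) := mul_pos hApos (Real.exp_pos _)
  have hlog' : Real.log (A / (A * Real.exp (-u₀))) = u₀ := by
    rw [← div_div, div_self hA0, one_div, Real.exp_neg, inv_inv, Real.log_exp]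
  have hlog : Real.log (A / (L - (L - A * Real.exp (-u₀)))) = u₀ := by
    rw [sub_sub_cancel, hlog']
  have upos : ∀ t ∈ Set.Ico (L - A * Real.exp (-u₀)) L, 0 < Real.log (A / (L - t)) :=
    fun t ht => hu₀pos.trans_le (calEnd_u_ge hApos ht)
  refine ⟨?_, sub_lt_self L ht₁pos, hlog, fun y hy => calEnd_hasDerivAt_g _ hApos hy.2 (upos y hy),
    fun y hy => (calEnd_hasDerivAt_h hApos hy.2 (upos y hy)).continuousAt.continuousWithinAt,
    fun y hy => ?_, ?_, fun y hy => calEnd_integral hApos hr hu₂ hlog' hy⟩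
  · -- `0 ≤ y₁`, i.e. `A e^{-u₀} ≤ L`, from `u₀ ≥ log(A/L)`
    rw [sub_nonneg]
    have h1 : Real.exp (-u₀) ≤ L / A := by
      have := Real.exp_le_exp.2 (neg_le_neg hu₁)
      rwa [Real.exp_neg (Real.log (A / L)), Real.exp_log (div_pos hApos hL), inv_div] at this
    calc A * Real.exp (-u₀) ≤ A * (L / A) := mul_le_mul_of_nonneg_left h1 hApos.le
      _ = L := mul_div_cancel₀ L hA0
  · -- the bounds `u₀^{-1/2}/(2r) ≤ g₂ ≤ K`, from `u^{-1/2} ≤ u₀^{-1/2}` and `u^{-1/2} ≥ 0`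
    have hut := calEnd_u_ge hApos hy
    have hsk := calEnd_rpow_le hu₀pos hut
    have hs0 : 0 ≤ Real.log (A / (L - y)) ^ (-(1 / 2 : ℝ)) :=
      Real.rpow_nonneg (hu₀pos.trans_le hut).le _
    constructor
    · nlinarith [hsk]
    · linarith [hs0]
  · -- the slope identity at `y₁`: `u₀^{-3/2} = u₀^{-1/2}/u₀`
    have h32 : u₀ ^ (-(3 / 2 : ℝ)) = u₀ ^ (-(1 / 2 : ℝ)) / u₀ := by
      rw [show (-(3 / 2 : ℝ)) = -(1 / 2 : ℝ) - 1 by norm_num, Real.rpow_sub hu₀pos, Real.rpow_one]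
    rw [h32]
    field_simp

end Summit.RiemannHypothesis.RiemannHypothesis.Theorems.LeeYangTelegraphString

end
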